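import Literature.MathematicalPhysics.QuantumFieldTheory.GaugeOSData
import Summits.QuantumFields.YangMills.Theorems.HypercubicLimit.Negative.AllTimesGapFalse
import HarnessLib

/-!
# `CriticalContinuumLimit` — line `Sketch`: the `Θ`-paired curvature correlator of the torus is
# bounded uniformly in the volume and the separation (stub `stub_thetaCorrBound`)

Support file for crux `stmt-QuantumFields-8762`
(`Summit.QuantumFields.YangMills.Theses.EquipartitionCriticality.CriticalContinuumLimit`): this is stub
`stub_thetaCorrBound` (torus input (T-bd)) of line `Sketch`
(skeleton `Cruxes/CriticalContinuumLimit/Lines/Sketch.lean`).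

What (pure bookkeeping).  For a lattice representation `r` of the compact group `G`, the torus Wilson
state `wilsonMeasure r.ρ β` on the periodic torus of side `2S+1` is a probability measure (tree
`isProbabilityMeasure_wilsonMeasure`, continuity of `r.ρ`), and the curvature species
`P = r.curvature.F = actionDensity r.ρ` is a bounded function of the gauge field, `|P| ≤ C` (the field
`LocalGaugeObservable.bounded`); so is `P ∘ Θ` with `Θ = gaugeTimeReflect` the bond time reflection,
with the same constant.  Hence the connected time correlation
`latticeConnectedCorr r.ρ β (2S+1) (P ∘ Θ) P n = ⟨(P∘Θ) · τₙ P⟩ − ⟨P∘Θ⟩⟨P⟩` satisfies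
`|⟨(P∘Θ) · τₙP⟩ − ⟨P∘Θ⟩⟨P⟩| ≤ C·C + C·C = 2 C²` for every half-side `S` and every separation `n`
(the tree's a priori bound `HypercubicLimit.Negative.abs_latticeConnectedCorr_le`, `2 C_A C_B` for two
bounded observables, applied with `A := P ∘ Θ`, `B := P`, `C_A = C_B = C`).
-/

noncomputable section

open MeasureTheory Filter Topology
open Literature.MathematicalPhysics.AQFT Literature.MathematicalPhysics.QuantumLattice
open Literature.MathematicalPhysics.QuantumFieldTheory

namespace Summit.QuantumFields.YangMills.Theorems.CriticalContinuumLimit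

variable {G : Type} [Group G] [TopologicalSpace G] [IsTopologicalGroup G] [CompactSpace G]
  [MeasurableSpace G] [BorelSpace G]

/-- **stub_thetaCorrBound** (torus input (T-bd) of the longitudinal reading of line `Sketch`;
bookkeeping): the `Θ`-paired curvature correlator
`latticeConnectedCorr r.ρ β (2S+1) (P ∘ gaugeTimeReflect) P n`, `P = r.curvature.F`, is bounded uniformly
in the torus half-side `S` and the separation `n` — by `2 C²` with `|P| ≤ C` the bound of the curvature
species (`P ∘ Θ` is bounded by the same constant). [folklore] -/
theorem stub_thetaCorrBound (r : LatticeRep G) (β : ℝ) :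
    ∃ B : ℝ, ∀ S n : ℕ,
      |latticeConnectedCorr r.ρ β (2 * S + 1) (r.curvature.F ∘ gaugeTimeReflect) r.curvature.F n| ≤ B := by
  obtain ⟨C, hC⟩ := r.curvature.bounded
  exact ⟨2 * (C * C), fun S n =>
    HypercubicLimit.Negative.abs_latticeConnectedCorr_le r β (2 * S + 1)
      (fun U => hC (gaugeTimeReflect U)) hC n⟩

end Summit.QuantumFields.YangMills.Theorems.CriticalContinuumLimit

end
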